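import Literature.MathematicalPhysics.QuantumFieldTheory.Balaban1983to89.T4LiveStructureGas
import Literature.MathematicalPhysics.QuantumFieldTheory.Balaban1983to89.T4Assembly

/-!
# W-AM′ Φ-SUPPLIER in NE7b's landed RECORDS CURRENCY — the island term of the weighted-average matching route is a
two-rate convolution, summable in the cutoff WITHOUT a young∕old cut
(cell `pub-balaban`, row NE7 ∕ node U5, ideation seat `b2b-balaban-t4-ne7-p2` gen 34; kernel bookkeeping; filed by courier, see COURIER NOTE)

What this file does.  Gen 33 typed the W-AM′ exit end-to-end (`g33/WAMPrimeExit.lean`: `WAMData.exit :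
Summable err → ∃ vol δ, Summable δ ∧ T4CauchySum.MatchingModConstants vol l₀ δ Z`, plug `genFunCauchy_of_wamData`) and
reduced `Summable err` to ONE displayed domination (`summable_err_of_ageProfile`'s `hisl`): per step `K`,
`Σ_{X ∈ ps K} δ_X · W_X ≤ Σ_{a+n=K} Φ a · θ^n` with a summable age profile `Φ`.  THIS FILE SUPPLIES `hisl` with the
island index, the count and the density majorants ALL read in the records currency that row NE7b's count chain landed
(`T4LiveStructureGas.liveSlots ∕ slotPrice`, `T4PersistentHistoryCount.slotPrice_le`; thresholds named in
`Summits/…/T4Continuum/Support/CountThresholdUniform.lean`, p205091):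
  §1 `budgetMass_le` — islands = live slots `⟨j, z, b, Q⟩` (birth step `j ≤ K`, birth cell `z ∈ Cell K (K − j)` with
     `#Cell K a ≤ V·Λ^a`, birth kind `b`, record `Q`); density majorant = record price `y` under NE7b's per-record
     ABSOLUTE majorant `y ≤ ρ_b e^{−κ₁ W b} ∏_{e ∈ Q} (e^{−κ₁ W e} η_e)` (its `hy`, verbatim) with per-step residual
     entropy `≤ η̄`; TERM-WISE island budget `δ ≤ φ_b · θ^j` for a slot born at step `j` (contraction achieved before the
     island froze; kind prefactor `φ_b ≥ 0` with the weighted birth residual `Σ_b φ_b ρ_b ≤ φ̄`).  THEN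
     `Σ_{liveSlots K} δ · y ≤ φ̄ e^{−κ₁} V · Σ_{j ≤ K} θ^j (Λσ)^{K−j}`, `σ = e^{η̄−κ₁}` — `slotPrice_le` applied to the
     φ-weighted prices, cells `V Λ^a`; NO `j⋆`, NO `hfrac`, NO threshold inside the statement.  `ageClassMass_le` is
     the age profile by name (slots born at one step `j` weigh `≤ ρ̄ e^{−κ₁} V (Λσ)^{K−j}`) = the drop stage's majorant
     (`j = 0` in run B's count: `d K ≤ C (Λσ)^{K+1}`, `summable_dropProfile`).
  §2 `summable_twoRate` — `K ↦ Σ_{j ≤ K} θ^j r^{K−j}` is summable for `0 ≤ θ < 1`, `0 ≤ r < 1` (Cauchy product of two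
     geometric series; `Finset.Nat.sum_antidiagonal_eq_sum_range_succ`); `budgetMass_le_antidiagonal` restates §1 in
     the LITERAL `hisl` shape `Σ_{kl ∈ antidiagonal K} Φ kl.1 · θ^kl.2` with `Φ a = C_P φ̄ e^{−κ₁} V (Λσ)^a`.
  §3 `summable_islandErr_records` — the W-AM′ error `d K + (e₀ K + Σ_{liveSlots K} δ · (C_P · y))` is summable in `K`
     from summable drop∕bulk majorants, the §1 hypotheses at EVERY `K` with `K`-UNIFORM constants, and the survival margin
     `Λ·e^{η̄−κ₁} < 1` (= NE7b's `hr`; = gen 31's `4·log L < p″∕N′`).  This is `g33`'s `err` with `ps K := liveSlots … K`,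
     `δX K := slotPrice (δ K)`, `W K := C_P · slotPrice (y K)`; composing with `g33/WAMData.exit` gives node U5.
  §4 `matchingModConstants_of_threshold` ∕ `summable_of_threshold` — if the displayed data are only available from a
     cutoff threshold `K₁` on (the records majorant is discharged under `irThresholdZ … ≤ log g_{K,K}⁻²`,
     `CountThresholdUniform.relWeightBoundZ_of_irThreshold`), ANY finite budgets below `K₁` keep
     `T4CauchySum.MatchingModConstants` and summability — the threshold is cosmetic at node U5.
  §5 `genFunCauchy_of_threshold` — the plug into the tree's apex consumer
     `T4Assembly.genFunCauchy_of_matchingModConstants` in that thresholded shape (per string `os`).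

CONTRAST WITH THE HYBRID ROUTE, by name.  The hybrid count END `T4LiveStructureGas.exists_relWeightBound_of_recordsGas`
needs a matching scale `j⋆ K ≤ K` leaving a positive fraction of OLD steps (`hfrac : c·K ≤ K − j⋆ K`), bad terms
labelled injectively by live families through an OLD slot, two runs' `GlobalDom`, and pays `recordsBudget` = (old mass)
× exp (live mass).  The W-AM′ island term needs NONE of `j⋆ ∕ hfrac ∕ str ∕ Bad`: young slots are cheap by their BUDGET
`θ^j`, old slots by their DENSITY `(Λσ)^{K−j}`, and the convolution of the two rates is summable as it stands (§2).  What
W-AM′ pays instead is recorded in `t4/T4-EST-NE7-P2.md` §31: t-uniform TERM-WISE per-history budgets around ONE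
t-independent constant (the hereditary clause, Q-GD-1) and density majorants under BOTH runs' normalised weights in the
absolute GD currency ((G2)(G3′)(G5), `g33/GDData`).

HONEST FRAMING.  continuum YM on T⁴ ⇐ BetaPertH ∧ nine spine estimates (0/9 proved); BetaPertH ⇐ (D1) ∧ (D4) ∧
CAP+tail; G-an2-4 gates asym, D1 and NE2/3/4.  Finite T⁴, rung (B)+1; NOT infinite volume, NOT mass gap, NOT Clay.
Every hypothesis below is an abstract finite-combinatorics ∕ real-analysis shape; NOTHING of Bałaban's is asserted (no
sentence of B14 [Balaban1988Convergent] or B16 [Balaban1989LargeFieldII] is typed); the per-record price majorant `hy`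
and the term-wise budgets `hδ` are the cell's located-UNPRINTED analytic inputs (GAPS G-ne7bp1-1; record §31 (31c)–(31e))
and are NOT discharged here; NE7 is NOT PRINTED and NOT PROVED — this file is bookkeeping of the implication
«records-currency count + term-wise budgets ⇒ the W-AM′ island term is summable», no more.

COURIER NOTE (2026-08-20, prover-b2b-balaban-t4-ne7-p3-g18-0, BINDER-OWNERS row NE7 co-owner #3): filed VERBATIM on behalf of the planner seat `b2b-balaban-t4-ne7-p2` (road W-AM′, skeleton `t4/skeletons/NE7-t4-ne7-p2.md`, its §1/§3 filing request (m1)–(m5)); content = the lineage's kernel scratch named below with ONLY the namespace moved from `T4NE7IdeasG3x` to `Summit.QuantumFields.BalabanUV.T4Continuum.WAM[.…]` and this note added; no statement changed.  Authorship and every claim in the docstrings are that seat's.  THIS FILE (m3 `WAMPhiSupplier`) = `t4/b2b-balaban-t4-ne7-p2/g34/PhiSupplier.lean` bf9bb0c4ebe030c2.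
-/

namespace Summit.QuantumFields.BalabanUV.T4Continuum.WAM.PhiSupplier

open Finset
open Literature.MathematicalPhysics.QuantumFieldTheory.Balaban1983to89
open T4PersistentHistoryCount T4LiveStructureGas

/-! ## §1 The budget-weighted live mass -/

section BudgetMass

variable {γ ε : Type*}

/-- **THE BUDGET-WEIGHTED LIVE MASS.**  Under NE7b's per-record price majorant (`hy`, for every birth step `j ≤ K`),
nonnegative prices, cells `#Cell K a ≤ V·Λ^a`, and TERM-WISE island budgets `δ ≤ φ_b · θ^j` for a slot born at step `j`
(`0 ≤ θ`, `0 ≤ φ_b`, `Σ_b φ_b ρ_b ≤ φ̄`):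
`Σ_{liveSlots K} δ · y ≤ φ̄ e^{−κ₁} · V · Σ_{j ≤ K} θ^j (Λ e^{η̄−κ₁})^{K−j}`.  No matching scale, no old∕young cut, no
threshold among the hypotheses. [folklore] -/
theorem budgetMass_le [DecidableEq ε] (Cell : ℕ → ℕ → Finset γ) {V Λ : ℝ}
    (hcell : ∀ K a, ((Cell K a).card : ℝ) ≤ V * Λ ^ a) (W : ε → ℕ) (step : ε → ℕ) (E B : ℕ → ℕ → Finset ε)
    {K : ℕ} (hE : ∀ j, ∀ e ∈ E K j, step e ∈ Ioc j K) {κ₁ ηbar : ℝ} (hκ : 0 ≤ κ₁) (ρ : ε → ℝ)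
    (hρ : ∀ j, ∀ b ∈ B K j, 0 ≤ ρ b) (η : ε → ℝ) (hη : ∀ j, ∀ e ∈ E K j, 0 ≤ η e)
    (hηbar : ∀ j, ∀ t ∈ Ioc j K, ∑ e ∈ E K j with step e = t, η e ≤ ηbar)
    (y : ℕ → γ → ε → Finset ε → ℝ)
    (hy0 : ∀ j ≤ K, ∀ z ∈ Cell K (K - j), ∀ b ∈ B K j, ∀ Q ∈ records W j K (E K j) b, 0 ≤ y j z b Q)
    (hy : ∀ j ≤ K, ∀ z ∈ Cell K (K - j), ∀ b ∈ B K j, ∀ Q ∈ records W j K (E K j) b,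
      y j z b Q ≤ ρ b * Real.exp (-(κ₁ * W b)) * ∏ e ∈ Q, (Real.exp (-(κ₁ * W e)) * η e))
    {θ : ℝ} (hθ : 0 ≤ θ) (φ : ε → ℝ) (hφ : ∀ j, ∀ b ∈ B K j, 0 ≤ φ b) {φbar : ℝ}
    (hφbar : ∀ j, ∑ b ∈ B K j, φ b * ρ b ≤ φbar) (δ : ℕ → γ → ε → Finset ε → ℝ)
    (hδ : ∀ j ≤ K, ∀ z ∈ Cell K (K - j), ∀ b ∈ B K j, ∀ Q ∈ records W j K (E K j) b, δ j z b Q ≤ φ b * θ ^ j) :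
    ∑ s ∈ liveSlots Cell W E B K, slotPrice δ s * slotPrice y s ≤
      φbar * Real.exp (-κ₁) * V * ∑ j ∈ range (K + 1), θ ^ j * (Λ * Real.exp (ηbar - κ₁)) ^ (K - j) := by
  set σ' := Real.exp (ηbar - κ₁) with hσ'
  have hσ0 : 0 ≤ σ' := (Real.exp_pos _).le
  have hφbar0 : 0 ≤ φbar :=
    le_trans (Finset.sum_nonneg fun b hb => mul_nonneg (hφ 0 b hb) (hρ 0 b hb)) (hφbar 0)
  have hC : 0 ≤ φbar * Real.exp (-κ₁) := mul_nonneg hφbar0 (Real.exp_pos _).le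
  rw [sum_liveSlots_eq]
  simp only [slotPrice_mk]
  have hslot : ∀ j ∈ range (K + 1), ∀ z ∈ Cell K (K - j),
      ∑ b ∈ B K j, ∑ Q ∈ records W j K (E K j) b, δ j z b Q * y j z b Q ≤
        θ ^ j * (φbar * Real.exp (-κ₁) * σ' ^ (K - j)) := by
    intro j hj z hz
    have hjK : j ≤ K := Nat.lt_succ_iff.1 (Finset.mem_range.1 hj)
    have h1 : ∑ b ∈ B K j, ∑ Q ∈ records W j K (E K j) b, δ j z b Q * y j z b Q ≤
        ∑ b ∈ B K j, ∑ Q ∈ records W j K (E K j) b, θ ^ j * (φ b * y j z b Q) := by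
      refine Finset.sum_le_sum fun b hb => Finset.sum_le_sum fun Q hQ => ?_
      calc δ j z b Q * y j z b Q ≤ φ b * θ ^ j * y j z b Q :=
            mul_le_mul_of_nonneg_right (hδ j hjK z hz b hb Q hQ) (hy0 j hjK z hz b hb Q hQ)
        _ = θ ^ j * (φ b * y j z b Q) := by ring
    have h2 : ∑ b ∈ B K j, ∑ Q ∈ records W j K (E K j) b, φ b * y j z b Q ≤
        φbar * Real.exp (-κ₁) * σ' ^ (K - j) :=
      slotPrice_le W hjK (E K j) (B K j) step (hE j) hκ (fun b => φ b * ρ b)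
        (fun b hb => mul_nonneg (hφ j b hb) (hρ j b hb)) (hφbar j) η (hη j) (hηbar j)
        (fun b Q => φ b * y j z b Q) fun b hb Q hQ => by
          calc φ b * y j z b Q
              ≤ φ b * (ρ b * Real.exp (-(κ₁ * W b)) * ∏ e ∈ Q, (Real.exp (-(κ₁ * W e)) * η e)) :=
                mul_le_mul_of_nonneg_left (hy j hjK z hz b hb Q hQ) (hφ j b hb)
            _ = φ b * ρ b * Real.exp (-(κ₁ * W b)) * ∏ e ∈ Q, (Real.exp (-(κ₁ * W e)) * η e) := by ring
    calc ∑ b ∈ B K j, ∑ Q ∈ records W j K (E K j) b, δ j z b Q * y j z b Q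
        ≤ ∑ b ∈ B K j, ∑ Q ∈ records W j K (E K j) b, θ ^ j * (φ b * y j z b Q) := h1
      _ = θ ^ j * ∑ b ∈ B K j, ∑ Q ∈ records W j K (E K j) b, φ b * y j z b Q := by
          simp only [← Finset.mul_sum]
      _ ≤ θ ^ j * (φbar * Real.exp (-κ₁) * σ' ^ (K - j)) := mul_le_mul_of_nonneg_left h2 (pow_nonneg hθ j)
  calc ∑ j ∈ range (K + 1), ∑ z ∈ Cell K (K - j), ∑ b ∈ B K j, ∑ Q ∈ records W j K (E K j) b,
          δ j z b Q * y j z b Q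
      ≤ ∑ j ∈ range (K + 1), ∑ _z ∈ Cell K (K - j), θ ^ j * (φbar * Real.exp (-κ₁) * σ' ^ (K - j)) :=
        Finset.sum_le_sum fun j hj => Finset.sum_le_sum fun z hz => hslot j hj z hz
    _ ≤ ∑ j ∈ range (K + 1), φbar * Real.exp (-κ₁) * V * (θ ^ j * (Λ * σ') ^ (K - j)) := by
        refine Finset.sum_le_sum fun j _ => ?_
        rw [Finset.sum_const, nsmul_eq_mul]
        calc ((Cell K (K - j)).card : ℝ) * (θ ^ j * (φbar * Real.exp (-κ₁) * σ' ^ (K - j)))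
            ≤ V * Λ ^ (K - j) * (θ ^ j * (φbar * Real.exp (-κ₁) * σ' ^ (K - j))) :=
              mul_le_mul_of_nonneg_right (hcell K (K - j))
                (mul_nonneg (pow_nonneg hθ j) (mul_nonneg hC (pow_nonneg hσ0 _)))
          _ = φbar * Real.exp (-κ₁) * V * (θ ^ j * (Λ * σ') ^ (K - j)) := by rw [mul_pow]; ring
    _ = φbar * Real.exp (-κ₁) * V * ∑ j ∈ range (K + 1), θ ^ j * (Λ * σ') ^ (K - j) := by
        rw [Finset.mul_sum]

/-- **THE AGE-CLASS MASS** (the age profile `Φ` by name, and the DROP STAGE's majorant): the live slots born at ONE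
step `j ≤ K` weigh at most `ρ̄ e^{−κ₁} · V · (Λσ)^{K−j}` — per cell `slotPrice_le`, cells `V Λ^{K−j}`.  With `j = 0` in
run B's `(K+1)`-step count this is the relative-mass majorant of B's surplus histories (a live island born at B's extra
finest scale), i.e. the drop budget `d K ≤ C · (Λσ)^{K+1}` of `g33/WAMData.drop` — geometric, hence summable
(`summable_dropProfile`). [folklore] -/
theorem ageClassMass_le [DecidableEq ε] (Cell : ℕ → ℕ → Finset γ) {V Λ : ℝ}
    (hcell : ∀ K a, ((Cell K a).card : ℝ) ≤ V * Λ ^ a) (W : ε → ℕ) (step : ε → ℕ) (E B : ℕ → ℕ → Finset ε)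
    {K : ℕ} (hE : ∀ j, ∀ e ∈ E K j, step e ∈ Ioc j K) {κ₁ ρbar ηbar : ℝ} (hκ : 0 ≤ κ₁) (ρ : ε → ℝ)
    (hρ : ∀ j, ∀ b ∈ B K j, 0 ≤ ρ b) (hρbar : ∀ j, ∑ b ∈ B K j, ρ b ≤ ρbar) (η : ε → ℝ)
    (hη : ∀ j, ∀ e ∈ E K j, 0 ≤ η e) (hηbar : ∀ j, ∀ t ∈ Ioc j K, ∑ e ∈ E K j with step e = t, η e ≤ ηbar)
    (y : ℕ → γ → ε → Finset ε → ℝ)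
    (hy : ∀ j ≤ K, ∀ z ∈ Cell K (K - j), ∀ b ∈ B K j, ∀ Q ∈ records W j K (E K j) b,
      y j z b Q ≤ ρ b * Real.exp (-(κ₁ * W b)) * ∏ e ∈ Q, (Real.exp (-(κ₁ * W e)) * η e))
    {j : ℕ} (hjK : j ≤ K) :
    ∑ z ∈ Cell K (K - j), ∑ b ∈ B K j, ∑ Q ∈ records W j K (E K j) b, y j z b Q ≤
      ρbar * Real.exp (-κ₁) * V * (Λ * Real.exp (ηbar - κ₁)) ^ (K - j) := by
  have hρbar0 : 0 ≤ ρbar := le_trans (Finset.sum_nonneg (hρ 0)) (hρbar 0)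
  have hC : 0 ≤ ρbar * Real.exp (-κ₁) := mul_nonneg hρbar0 (Real.exp_pos _).le
  have hslot : ∀ z ∈ Cell K (K - j), ∑ b ∈ B K j, ∑ Q ∈ records W j K (E K j) b, y j z b Q ≤
      ρbar * Real.exp (-κ₁) * Real.exp (ηbar - κ₁) ^ (K - j) := fun z hz =>
    slotPrice_le W hjK (E K j) (B K j) step (hE j) hκ ρ (hρ j) (hρbar j) η (hη j) (hηbar j) (y j z) (hy j hjK z hz)
  calc ∑ z ∈ Cell K (K - j), ∑ b ∈ B K j, ∑ Q ∈ records W j K (E K j) b, y j z b Q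
      ≤ ∑ _z ∈ Cell K (K - j), ρbar * Real.exp (-κ₁) * Real.exp (ηbar - κ₁) ^ (K - j) := Finset.sum_le_sum hslot
    _ ≤ V * Λ ^ (K - j) * (ρbar * Real.exp (-κ₁) * Real.exp (ηbar - κ₁) ^ (K - j)) := by
        rw [Finset.sum_const, nsmul_eq_mul]
        exact mul_le_mul_of_nonneg_right (hcell K (K - j)) (mul_nonneg hC (pow_nonneg (Real.exp_pos _).le _))
    _ = ρbar * Real.exp (-κ₁) * V * (Λ * Real.exp (ηbar - κ₁)) ^ (K - j) := by rw [mul_pow]; ring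

/-- the drop profile `C · r^{K+1}` is summable in `K` for `0 ≤ r < 1` [folklore] -/
theorem summable_dropProfile (C : ℝ) {r : ℝ} (hr0 : 0 ≤ r) (hr1 : r < 1) :
    Summable fun K : ℕ => C * r ^ (K + 1) := by
  have h := (summable_geometric_of_lt_one hr0 hr1).mul_left (C * r)
  refine h.congr fun K => ?_
  rw [pow_succ]; ring

end BudgetMass

/-! ## §2 The two-rate convolution is summable — no cut -/

section TwoRate

/-- the age sum of §1 in antidiagonal form: `Σ_{j ≤ K} θ^j r^{K−j} = Σ_{(a,n), a+n=K} r^a θ^n` [folklore] -/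
theorem sum_range_twoRate_eq_antidiagonal (θ r : ℝ) (K : ℕ) :
    ∑ j ∈ range (K + 1), θ ^ j * r ^ (K - j) = ∑ kl ∈ antidiagonal K, r ^ kl.1 * θ ^ kl.2 := by
  rw [← Finset.Nat.sum_antidiagonal_eq_sum_range_succ (fun j a => θ ^ j * r ^ a) K,
    ← Finset.Nat.sum_antidiagonal_swap]
  exact Finset.sum_congr rfl fun kl _ => by simp only [Prod.fst_swap, Prod.snd_swap, mul_comm]

/-- **SUMMABILITY OF THE TWO-RATE CONVOLUTION** `K ↦ Σ_{j ≤ K} θ^j · r^{K−j}` for `0 ≤ θ < 1`, `0 ≤ r < 1`: the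
Cauchy product of two geometric series.  Young islands (`j` near `K`) are cheap by the budget `θ^j`, old ones by the
density `r^{K−j}`; NO matching scale separating them is needed. [folklore] -/
theorem summable_twoRate {θ r : ℝ} (hθ0 : 0 ≤ θ) (hθ1 : θ < 1) (hr0 : 0 ≤ r) (hr1 : r < 1) :
    Summable fun K : ℕ => ∑ j ∈ range (K + 1), θ ^ j * r ^ (K - j) := by
  have hθn : Summable fun n => ‖θ ^ n‖ := by
    simpa [Real.norm_of_nonneg (pow_nonneg hθ0 _)] using summable_geometric_of_lt_one hθ0 hθ1
  have hrn : Summable fun n => ‖r ^ n‖ := by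
    simpa [Real.norm_of_nonneg (pow_nonneg hr0 _)] using summable_geometric_of_lt_one hr0 hr1
  have h := (summable_norm_sum_mul_antidiagonal_of_summable_norm hθn hrn).of_norm
  refine h.congr fun K => ?_
  exact Finset.Nat.sum_antidiagonal_eq_sum_range_succ (fun j a => θ ^ j * r ^ a) K

/-- the two-rate sum is nonnegative [folklore] -/
theorem twoRate_nonneg {θ r : ℝ} (hθ0 : 0 ≤ θ) (hr0 : 0 ≤ r) (K : ℕ) :
    0 ≤ ∑ j ∈ range (K + 1), θ ^ j * r ^ (K - j) :=
  Finset.sum_nonneg fun _ _ => mul_nonneg (pow_nonneg hθ0 _) (pow_nonneg hr0 _)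

/-- the two-rate sum is at most the full Cauchy product `(1−θ)⁻¹ (1−r)⁻¹` — a `K`-UNIFORM bound (so the island term of
W-AM′ is bounded, not only summable, by constants × `φ̄ V`). [folklore] -/
theorem twoRate_le {θ r : ℝ} (hθ0 : 0 ≤ θ) (hθ1 : θ < 1) (hr0 : 0 ≤ r) (hr1 : r < 1) (K : ℕ) :
    ∑ j ∈ range (K + 1), θ ^ j * r ^ (K - j) ≤ (1 - θ)⁻¹ * (1 - r)⁻¹ := by
  calc ∑ j ∈ range (K + 1), θ ^ j * r ^ (K - j)
      ≤ ∑ j ∈ range (K + 1), θ ^ j * (1 - r)⁻¹ := by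
        refine Finset.sum_le_sum fun j _ => mul_le_mul_of_nonneg_left ?_ (pow_nonneg hθ0 _)
        calc r ^ (K - j) ≤ ∑' n, r ^ n :=
              (summable_geometric_of_lt_one hr0 hr1).le_tsum (K - j) fun n _ => pow_nonneg hr0 n
          _ = (1 - r)⁻¹ := tsum_geometric_of_lt_one hr0 hr1
    _ = (∑ j ∈ range (K + 1), θ ^ j) * (1 - r)⁻¹ := by rw [Finset.sum_mul]
    _ ≤ (∑' j, θ ^ j) * (1 - r)⁻¹ := by
        have h1r : 0 ≤ (1 - r)⁻¹ := inv_nonneg.2 (by linarith)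
        exact mul_le_mul_of_nonneg_right
          ((summable_geometric_of_lt_one hθ0 hθ1).sum_le_tsum _ fun j _ => pow_nonneg hθ0 j) h1r
    _ = (1 - θ)⁻¹ * (1 - r)⁻¹ := by rw [tsum_geometric_of_lt_one hθ0 hθ1]

variable {γ ε : Type*}

/-- **§1 IN THE LITERAL `hisl` SHAPE of `g33/summable_err_of_ageProfile`**: with the pinned-fraction constant `C_P ≥ 0`
of the GD density discharge (`g33/pinnedFraction_le`) and the AGE PROFILE `Φ a := C_P · φ̄ e^{−κ₁} V · (Λσ)^a`,
`Σ_{liveSlots K} δ · (C_P · y) ≤ Σ_{kl ∈ antidiagonal K} Φ kl.1 · θ^kl.2`. [folklore] -/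
theorem budgetMass_le_antidiagonal [DecidableEq ε] (Cell : ℕ → ℕ → Finset γ) {V Λ : ℝ}
    (hcell : ∀ K a, ((Cell K a).card : ℝ) ≤ V * Λ ^ a) (W : ε → ℕ) (step : ε → ℕ) (E B : ℕ → ℕ → Finset ε)
    {K : ℕ} (hE : ∀ j, ∀ e ∈ E K j, step e ∈ Ioc j K) {κ₁ ηbar : ℝ} (hκ : 0 ≤ κ₁) (ρ : ε → ℝ)
    (hρ : ∀ j, ∀ b ∈ B K j, 0 ≤ ρ b) (η : ε → ℝ) (hη : ∀ j, ∀ e ∈ E K j, 0 ≤ η e)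
    (hηbar : ∀ j, ∀ t ∈ Ioc j K, ∑ e ∈ E K j with step e = t, η e ≤ ηbar)
    (y : ℕ → γ → ε → Finset ε → ℝ)
    (hy0 : ∀ j ≤ K, ∀ z ∈ Cell K (K - j), ∀ b ∈ B K j, ∀ Q ∈ records W j K (E K j) b, 0 ≤ y j z b Q)
    (hy : ∀ j ≤ K, ∀ z ∈ Cell K (K - j), ∀ b ∈ B K j, ∀ Q ∈ records W j K (E K j) b,
      y j z b Q ≤ ρ b * Real.exp (-(κ₁ * W b)) * ∏ e ∈ Q, (Real.exp (-(κ₁ * W e)) * η e))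
    {θ : ℝ} (hθ : 0 ≤ θ) (φ : ε → ℝ) (hφ : ∀ j, ∀ b ∈ B K j, 0 ≤ φ b) {φbar : ℝ}
    (hφbar : ∀ j, ∑ b ∈ B K j, φ b * ρ b ≤ φbar) (δ : ℕ → γ → ε → Finset ε → ℝ)
    (hδ : ∀ j ≤ K, ∀ z ∈ Cell K (K - j), ∀ b ∈ B K j, ∀ Q ∈ records W j K (E K j) b, δ j z b Q ≤ φ b * θ ^ j)
    {CP : ℝ} (hCP : 0 ≤ CP) :
    ∑ s ∈ liveSlots Cell W E B K, slotPrice δ s * (CP * slotPrice y s) ≤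
      ∑ kl ∈ antidiagonal K,
        (CP * (φbar * Real.exp (-κ₁) * V) * (Λ * Real.exp (ηbar - κ₁)) ^ kl.1) * θ ^ kl.2 := by
  have h := budgetMass_le Cell hcell W step E B hE hκ ρ hρ η hη hηbar y hy0 hy hθ φ hφ hφbar δ hδ
  have e1 : ∑ s ∈ liveSlots Cell W E B K, slotPrice δ s * (CP * slotPrice y s) =
      CP * ∑ s ∈ liveSlots Cell W E B K, slotPrice δ s * slotPrice y s := by
    rw [Finset.mul_sum]
    exact Finset.sum_congr rfl fun s _ => by ring
  have e2 : ∑ kl ∈ antidiagonal K,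
        (CP * (φbar * Real.exp (-κ₁) * V) * (Λ * Real.exp (ηbar - κ₁)) ^ kl.1) * θ ^ kl.2 =
      CP * (φbar * Real.exp (-κ₁) * V *
        ∑ j ∈ range (K + 1), θ ^ j * (Λ * Real.exp (ηbar - κ₁)) ^ (K - j)) := by
    rw [sum_range_twoRate_eq_antidiagonal, Finset.mul_sum, Finset.mul_sum]
    exact Finset.sum_congr rfl fun kl _ => by ring
  rw [e1, e2]
  exact mul_le_mul_of_nonneg_left h hCP

end TwoRate

/-! ## §3 The W-AM′ error in the records currency is summable in the cutoff -/

section IslandErr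

variable {γ ε : Type*}

/-- **SUMMABILITY OF THE W-AM′ ERROR, records instance.**  Per cutoff `K`: the §1 hypotheses with `K`-UNIFORM constants
(`V, Λ, κ₁, η̄, φ̄, θ, C_P`; the kind data `ρ`, `φ`, `η` and the universes `Cell K`, `E K`, `B K` may depend on `K`),
drop and bulk budgets `0 ≤ d K ≤ dd K`, `0 ≤ e₀ K ≤ ee K` with `dd`, `ee` summable, the survival margin
`Λ·e^{η̄−κ₁} < 1` (NE7b's `hr`) and `θ < 1`.  THEN the step error of the route,
`err K = d K + (e₀ K + Σ_{liveSlots K} δ_K · (C_P · y_K))` — `g33/WAMData.err` with `ps K := liveSlots … K`,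
`δX K := slotPrice (δ K)`, `W K := C_P · slotPrice (y K)` — is summable.  Composing with `g33/WAMData.exit` gives the
node-U5 shape `∃ vol δ, Summable δ ∧ MatchingModConstants vol l₀ δ Z`. [folklore] -/
theorem summable_islandErr_records [DecidableEq ε] (Cell : ℕ → ℕ → Finset γ) {V Λ : ℝ} (hΛ : 0 ≤ Λ)
    (hcell : ∀ K a, ((Cell K a).card : ℝ) ≤ V * Λ ^ a) (W : ε → ℕ) (step : ε → ℕ) (E B : ℕ → ℕ → Finset ε)
    (hE : ∀ K j, ∀ e ∈ E K j, step e ∈ Ioc j K) {κ₁ ηbar : ℝ} (hκ : 0 ≤ κ₁) (ρ : ℕ → ε → ℝ)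
    (hρ : ∀ K j, ∀ b ∈ B K j, 0 ≤ ρ K b) (η : ℕ → ε → ℝ) (hη : ∀ K j, ∀ e ∈ E K j, 0 ≤ η K e)
    (hηbar : ∀ K j, ∀ t ∈ Ioc j K, ∑ e ∈ E K j with step e = t, η K e ≤ ηbar)
    (hr : Λ * Real.exp (ηbar - κ₁) < 1) (y : ℕ → ℕ → γ → ε → Finset ε → ℝ)
    (hy0 : ∀ K, ∀ j ≤ K, ∀ z ∈ Cell K (K - j), ∀ b ∈ B K j, ∀ Q ∈ records W j K (E K j) b, 0 ≤ y K j z b Q)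
    (hy : ∀ K, ∀ j ≤ K, ∀ z ∈ Cell K (K - j), ∀ b ∈ B K j, ∀ Q ∈ records W j K (E K j) b,
      y K j z b Q ≤ ρ K b * Real.exp (-(κ₁ * W b)) * ∏ e ∈ Q, (Real.exp (-(κ₁ * W e)) * η K e))
    {θ : ℝ} (hθ0 : 0 ≤ θ) (hθ1 : θ < 1) (φ : ℕ → ε → ℝ) (hφ : ∀ K j, ∀ b ∈ B K j, 0 ≤ φ K b) {φbar : ℝ}
    (hφbar : ∀ K j, ∑ b ∈ B K j, φ K b * ρ K b ≤ φbar) (δ : ℕ → ℕ → γ → ε → Finset ε → ℝ)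
    (hδ0 : ∀ K, ∀ j ≤ K, ∀ z ∈ Cell K (K - j), ∀ b ∈ B K j, ∀ Q ∈ records W j K (E K j) b, 0 ≤ δ K j z b Q)
    (hδ : ∀ K, ∀ j ≤ K, ∀ z ∈ Cell K (K - j), ∀ b ∈ B K j, ∀ Q ∈ records W j K (E K j) b,
      δ K j z b Q ≤ φ K b * θ ^ j)
    {CP : ℝ} (hCP : 0 ≤ CP) (d e₀ dd ee : ℕ → ℝ) (hd0 : ∀ K, 0 ≤ d K) (hd : ∀ K, d K ≤ dd K) (hdds : Summable dd)
    (he0 : ∀ K, 0 ≤ e₀ K) (he : ∀ K, e₀ K ≤ ee K) (hees : Summable ee) :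
    Summable fun K => d K + (e₀ K + ∑ s ∈ liveSlots Cell W E B K, slotPrice (δ K) s * (CP * slotPrice (y K) s)) := by
  set r := Λ * Real.exp (ηbar - κ₁) with hr'
  have hr0 : 0 ≤ r := mul_nonneg hΛ (Real.exp_pos _).le
  set C := CP * (φbar * Real.exp (-κ₁) * V) with hC
  have hmaj : Summable fun K => dd K + (ee K + C * ∑ j ∈ range (K + 1), θ ^ j * r ^ (K - j)) :=
    hdds.add (hees.add ((summable_twoRate hθ0 hθ1 hr0 hr).mul_left C))
  refine Summable.of_nonneg_of_le (fun K => ?_) (fun K => ?_) hmaj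
  · refine add_nonneg (hd0 K) (add_nonneg (he0 K) (Finset.sum_nonneg fun s hs => ?_))
    obtain ⟨j, z, b, Q⟩ := s
    simp only [liveSlots, Finset.mem_sigma, Finset.mem_range] at hs
    have hjK : j ≤ K := Nat.lt_succ_iff.1 hs.1
    simp only [slotPrice_mk]
    exact mul_nonneg (hδ0 K j hjK z hs.2.1 b hs.2.2.1 Q hs.2.2.2)
      (mul_nonneg hCP (hy0 K j hjK z hs.2.1 b hs.2.2.1 Q hs.2.2.2))
  · refine add_le_add (hd K) (add_le_add (he K) ?_)
    have h := budgetMass_le Cell hcell W step E B (hE K) hκ (ρ K) (hρ K) (η K) (hη K) (hηbar K) (y K)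
      (hy0 K) (hy K) hθ0 (φ K) (hφ K) (hφbar K) (δ K) (hδ K)
    have e1 : ∑ s ∈ liveSlots Cell W E B K, slotPrice (δ K) s * (CP * slotPrice (y K) s) =
        CP * ∑ s ∈ liveSlots Cell W E B K, slotPrice (δ K) s * slotPrice (y K) s := by
      rw [Finset.mul_sum]
      exact Finset.sum_congr rfl fun s _ => by ring
    rw [e1, hC, mul_assoc]
    exact mul_le_mul_of_nonneg_left h hCP

/-- **THE ISLAND TERM IS `K`-UNIFORMLY BOUNDED** (not only summable): `Σ_{liveSlots K} δ · y ≤ φ̄ e^{−κ₁} V ∕ ((1−θ)(1−Λσ))`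
— the W-AM′ analogue of `T4LiveStructureGas.liveMass_le`'s `K`-uniformity. [folklore] -/
theorem budgetMass_le_uniform [DecidableEq ε] (Cell : ℕ → ℕ → Finset γ) {V Λ : ℝ} (hV : 0 ≤ V) (hΛ : 0 ≤ Λ)
    (hcell : ∀ K a, ((Cell K a).card : ℝ) ≤ V * Λ ^ a) (W : ε → ℕ) (step : ε → ℕ) (E B : ℕ → ℕ → Finset ε)
    {K : ℕ} (hE : ∀ j, ∀ e ∈ E K j, step e ∈ Ioc j K) {κ₁ ηbar : ℝ} (hκ : 0 ≤ κ₁) (ρ : ε → ℝ)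
    (hρ : ∀ j, ∀ b ∈ B K j, 0 ≤ ρ b) (η : ε → ℝ) (hη : ∀ j, ∀ e ∈ E K j, 0 ≤ η e)
    (hηbar : ∀ j, ∀ t ∈ Ioc j K, ∑ e ∈ E K j with step e = t, η e ≤ ηbar)
    (hr : Λ * Real.exp (ηbar - κ₁) < 1) (y : ℕ → γ → ε → Finset ε → ℝ)
    (hy0 : ∀ j ≤ K, ∀ z ∈ Cell K (K - j), ∀ b ∈ B K j, ∀ Q ∈ records W j K (E K j) b, 0 ≤ y j z b Q)
    (hy : ∀ j ≤ K, ∀ z ∈ Cell K (K - j), ∀ b ∈ B K j, ∀ Q ∈ records W j K (E K j) b,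
      y j z b Q ≤ ρ b * Real.exp (-(κ₁ * W b)) * ∏ e ∈ Q, (Real.exp (-(κ₁ * W e)) * η e))
    {θ : ℝ} (hθ0 : 0 ≤ θ) (hθ1 : θ < 1) (φ : ε → ℝ) (hφ : ∀ j, ∀ b ∈ B K j, 0 ≤ φ b) {φbar : ℝ}
    (hφbar : ∀ j, ∑ b ∈ B K j, φ b * ρ b ≤ φbar) (δ : ℕ → γ → ε → Finset ε → ℝ)
    (hδ : ∀ j ≤ K, ∀ z ∈ Cell K (K - j), ∀ b ∈ B K j, ∀ Q ∈ records W j K (E K j) b, δ j z b Q ≤ φ b * θ ^ j) :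
    ∑ s ∈ liveSlots Cell W E B K, slotPrice δ s * slotPrice y s ≤
      φbar * Real.exp (-κ₁) * V * ((1 - θ)⁻¹ * (1 - Λ * Real.exp (ηbar - κ₁))⁻¹) := by
  have hφbar0 : 0 ≤ φbar :=
    le_trans (Finset.sum_nonneg fun b hb => mul_nonneg (hφ 0 b hb) (hρ 0 b hb)) (hφbar 0)
  have hC : 0 ≤ φbar * Real.exp (-κ₁) * V := mul_nonneg (mul_nonneg hφbar0 (Real.exp_pos _).le) hV
  exact (budgetMass_le Cell hcell W step E B hE hκ ρ hρ η hη hηbar y hy0 hy hθ0 φ hφ hφbar δ hδ).trans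
    (mul_le_mul_of_nonneg_left
      (twoRate_le hθ0 hθ1 (mul_nonneg hΛ (Real.exp_pos _).le) hr K) hC)

end IslandErr

/-! ## §4 A cutoff threshold is cosmetic at node U5 -/

section Threshold

/-- **MATCHING MOD CONSTANTS FROM A THRESHOLD ON.**  If the t-uniform bound around a t-independent constant holds from
`K₁` on with budgets `δ`, and below `K₁` the consecutive log-partition functions differ by at most `vol · b K` on the
window (ANY finite numbers; constant `0`), then `T4CauchySum.MatchingModConstants vol l₀ δ' Z` with
`δ' K = if K₁ ≤ K then δ K else b K`. [folklore] -/
theorem matchingModConstants_of_threshold {vol l₀ : ℝ} {Z : ℕ → ℝ → ℝ} {δ b : ℕ → ℝ} {K₁ : ℕ}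
    (hδ : ∀ K, K₁ ≤ K → ∃ c : ℝ, ∀ t : ℝ, |t| ≤ l₀ →
      |Real.log (Z (K + 1) t) - Real.log (Z K t) - c| ≤ vol * δ K)
    (hb : ∀ K, K < K₁ → ∀ t : ℝ, |t| ≤ l₀ → |Real.log (Z (K + 1) t) - Real.log (Z K t)| ≤ vol * b K) :
    T4CauchySum.MatchingModConstants vol l₀ (fun K => if K₁ ≤ K then δ K else b K) Z := by
  intro K
  by_cases hK : K₁ ≤ K
  · simp only [if_pos hK]; exact hδ K hK
  · simp only [if_neg hK]
    exact ⟨0, fun t ht => by simpa using hb K (lt_of_not_ge hK) t ht⟩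

/-- … and the thresholded budget is summable iff the tail is: a finite modification. [folklore] -/
theorem summable_of_threshold {δ b : ℕ → ℝ} {K₁ : ℕ} (hδ : Summable δ) :
    Summable fun K => if K₁ ≤ K then δ K else b K := by
  have h1 : Summable fun n => δ (n + K₁) := (summable_nat_add_iff K₁).2 hδ
  have h2 : Summable fun n => (fun K => if K₁ ≤ K then δ K else b K) (n + K₁) :=
    h1.congr fun n => by simp
  exact (summable_nat_add_iff K₁).1 h2

/-- **THE NODE-U5 SHAPE FROM A THRESHOLD ON** (`∃ vol δ, Summable δ ∧ MatchingModConstants vol l₀ δ Z`, the binder of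
`T4Assembly.genFunCauchy_of_matchingModConstants`). [folklore] -/
theorem exit_of_threshold {vol l₀ : ℝ} {Z : ℕ → ℝ → ℝ} {δ b : ℕ → ℝ} {K₁ : ℕ} (hsum : Summable δ)
    (hδ : ∀ K, K₁ ≤ K → ∃ c : ℝ, ∀ t : ℝ, |t| ≤ l₀ →
      |Real.log (Z (K + 1) t) - Real.log (Z K t) - c| ≤ vol * δ K)
    (hb : ∀ K, K < K₁ → ∀ t : ℝ, |t| ≤ l₀ → |Real.log (Z (K + 1) t) - Real.log (Z K t)| ≤ vol * b K) :
    ∃ (vol' : ℝ) (δ' : ℕ → ℝ), Summable δ' ∧ T4CauchySum.MatchingModConstants vol' l₀ δ' Z :=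
  ⟨vol, _, summable_of_threshold hsum, matchingModConstants_of_threshold hδ hb⟩

end Threshold

/-! ## §5 The plug into the tree's apex consumer, thresholded shape -/

section Plug

open T4Assembly

variable {G : Type*} [GaugeGroup G] [MeasurableSpace G] [HaarData G] {O : Type*}

/-- **THE PLUG (thresholded).**  Per string `os`: a threshold `K₁`, summable budgets `δ` with the t-uniform matching
bound around t-independent constants from `K₁` on, and crude window bounds below `K₁` ⇒ the tree's `GenFunCauchy S l₀`
— by `T4Assembly.genFunCauchy_of_matchingModConstants`.  No `HybridNE7` member is used. [folklore] -/
theorem genFunCauchy_of_threshold (S : Missing.TorusScheme G O) {l₀ : ℝ} (hl₀ : 0 ≤ l₀)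
    (h : ∀ os : List O, ∃ (vol : ℝ) (K₁ : ℕ) (δ b : ℕ → ℝ), Summable δ ∧
      (∀ K, K₁ ≤ K → ∃ c : ℝ, ∀ t : ℝ, |t| ≤ l₀ →
        |Real.log (T4GenFunBounds.schemeZ S os (K + 1) t) - Real.log (T4GenFunBounds.schemeZ S os K t) - c| ≤
          vol * δ K) ∧
      (∀ K, K < K₁ → ∀ t : ℝ, |t| ≤ l₀ →
        |Real.log (T4GenFunBounds.schemeZ S os (K + 1) t) - Real.log (T4GenFunBounds.schemeZ S os K t)| ≤
          vol * b K)) :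
    GenFunCauchy S l₀ :=
  genFunCauchy_of_matchingModConstants S hl₀ fun os => by
    obtain ⟨vol, K₁, δ, b, hsum, hδ, hb⟩ := h os
    exact exit_of_threshold hsum hδ hb

end Plug

end Summit.QuantumFields.BalabanUV.T4Continuum.WAM.PhiSupplier
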